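import Mathlib
import Summits.MatrixMultiplication.MatrixMultiplication.Theorems.LevelGradedCohnUmansLieRankDesignsStubRankSepOfFreeFrames

/-!
# The unitriangular filter is sharp: `U_m(𝔽_p)` passes the identity test at level `m − 1` (crux `SubgroupIdentityDesigns`, 14079)

Companion of `Negative/UnitriangularLevel.lean` (`no_levelK_design_of_unitriangular`: for `k + 2 ≤ m` a subgroup triple
whose `H₁` contains the lower unitriangular group `U_m(𝔽_p)` admits NO level-`k` identity design).  Here the converse
half: as soon as `m ≤ k + 1`, EVERY set `S` of lower unitriangular matrices — in particular `U_m(𝔽_p)` itself, or any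
subgroup triple inside it — admits a level-`k` identity test function: an `f = Σ_{rk M ≤ k} c_M ψ(tr(M·))` with
`f(1) = 1` and `f(s) = 0` for `s ∈ S ∖ {1}` (`idTest_of_unitriangular`, `levelK_idDesign_of_unitriangular`).  So the
hypothesis `k + 2 ≤ m` of the negative lemma cannot be weakened: the identity-test level of `U_m(𝔽_p)` is EXACTLY
`m − 1` (cell B2b-5, `run/shared/lean/b2b/levelgraded-cu/ORACLE-g2.md` §G3 / `ORACLE-g3.md`: the kernel dimension
`K(m, k)` of `ℂ[U_m] → End ℂ[M_{m×k}]` is `> 0` iff `k ≤ m − 2`).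

Mechanism (the general FREE-FRAME criterion, `idTest_of_freeFrame`): if some frame `U₀ ∈ M_{m×k}(𝔽_p)` is fixed by
no element of `S` other than `1`, then the single-frame indicator `g ↦ 1[g U₀ = U₀]` — a level-`k` function by the landed
frame duality (`LieRankDesigns.FreeFrame.exists_frameIndicatorCoeff`, p118829, from `stub_frameFnLevel`, p93384) — is
`1` at `1` and `0` on `S ∖ {1}`.  For lower unitriangular `S` the partial identity frame `(U₀)_{ij} = [i = j]`
(`m × k`, `k ≥ m − 1`; written inline as `Matrix.of …`) is free: `s U₀ = U₀` pins the first `m − 1` columns of `s` to those of `1`, and the last column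
of a lower unitriangular matrix is `e_{m−1}` anyway.  Sorry-free; standard axioms.  VALUE = a theorem about one test
family (sharpness of a negative lemma), NOT summit progress; the crux item stays open.
-/

set_option linter.dupNamespace false

noncomputable section

open scoped BigOperators Classical
open Summit.MatrixMultiplication.MatrixMultiplication.Theorems.LieRankDesigns.Negative (GLm Mat fourierFn RankSupp)
open Summit.MatrixMultiplication.MatrixMultiplication.Theorems.LieRankDesigns.FreeFrame (exists_frameIndicatorCoeff)

namespace Summit.MatrixMultiplication.MatrixMultiplication.Theorems.SubgroupIdentityDesigns.Negative

variable {p m : ℕ} [Fact p.Prime]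

/-- **Free-frame criterion for the identity test.**  If a frame `U₀ ∈ M_{m×k}(𝔽_p)` is fixed by no element of
`S ⊆ GL_m(𝔽_p)` except `1`, then some level-`k` function is `1` at `1` and `0` on `S ∖ {1}`. -/
theorem idTest_of_freeFrame {k : ℕ} (S : Set (GLm p m)) (U₀ : Matrix (Fin m) (Fin k) (ZMod p))
    (hfree : ∀ s ∈ S, (s : Mat p m) * U₀ = U₀ → s = 1) :
    ∃ c : Mat p m → ℂ, RankSupp k c ∧ fourierFn c 1 = 1 ∧ ∀ s ∈ S, s ≠ 1 → fourierFn c s = 0 := by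
  obtain ⟨c, hc, hcf⟩ := exists_frameIndicatorCoeff (p := p) U₀ U₀
  refine ⟨c, hc, ?_, fun s hs hs1 => ?_⟩
  · rw [hcf]
    simp
  · rw [hcf, if_neg fun h => hs1 (hfree s hs h)]

/-- Entries of `s · U₀` for the partial identity frame: column `j` of `s U₀` is column `j` of `s` (when `j < m`). -/
theorem mul_idFrame_apply {k : ℕ} (s : Mat p m) (a : Fin m) (j : Fin k) (b : Fin m) (hjb : b.val = j.val) :
    (s * (Matrix.of fun (i : Fin m) (j : Fin k) => if i.val = j.val then (1 : ZMod p) else 0)) a j = s a b := by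
  rw [Matrix.mul_apply]
  rw [Finset.sum_eq_single b]
  · simp [hjb]
  · intro l _ hlb
    have : l.val ≠ j.val := fun h => hlb (Fin.ext (by rw [h, ← hjb]))
    simp [this]
  · intro h; exact (h (Finset.mem_univ b)).elim

/-- **A lower unitriangular matrix fixing the partial identity frame with `k ≥ m − 1` columns is `1`.** -/
theorem eq_one_of_unitriangular_of_mul_idFrame {k : ℕ} (hkm : m ≤ k + 1) (s : GLm p m)
    (hs : ∀ a b : Fin m, ((s : Mat p m) - 1) a b ≠ 0 → b < a)
    (hfix : (s : Mat p m) * (Matrix.of fun (i : Fin m) (j : Fin k) => if i.val = j.val then (1 : ZMod p) else 0) =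
      (Matrix.of fun (i : Fin m) (j : Fin k) => if i.val = j.val then (1 : ZMod p) else 0)) :
    s = 1 := by
  refine Units.ext ?_
  ext a b
  by_cases hab : b < a
  · -- column `b` is one of the first `m - 1` columns: read it off the frame
    have hbk : b.val < k := by
      have h1 : b.val < a.val := hab
      have h2 : a.val < m := a.isLt
      omega
    have h := congrFun (congrFun hfix a) ⟨b.val, hbk⟩
    rw [mul_idFrame_apply (s : Mat p m) a ⟨b.val, hbk⟩ b rfl] at h
    have hne : a ≠ b := fun h' => by rw [h'] at hab; exact lt_irrefl _ hab
    have hne' : a.val ≠ b.val := fun h' => hne (Fin.ext h')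
    rw [h]
    simp [hne', Matrix.one_apply_ne hne]
  · -- on or above the diagonal `s - 1` vanishes by hypothesis
    have h0 : ((s : Mat p m) - 1) a b = 0 := by
      by_contra h; exact hab (hs a b h)
    rw [Matrix.sub_apply] at h0
    have : (s : Mat p m) a b = (1 : Mat p m) a b := sub_eq_zero.mp h0
    simpa using this

/-- **`U_m(𝔽_p)` passes the identity test at every level `k ≥ m − 1`** (sharpness of
`no_levelK_design_of_unitriangular`).  For any set `S` of lower unitriangular elements of `GL_m(𝔽_p)` and
`m ≤ k + 1` there is a rank-`≤ k`-supported table `c` with `Σ_M c_M ψ(tr M) = 1` and `Σ_M c_M ψ(tr(M s)) = 0` for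
all `s ∈ S ∖ {1}`. -/
theorem idTest_of_unitriangular (k : ℕ) (hkm : m ≤ k + 1) (S : Set (GLm p m))
    (hS : ∀ s ∈ S, ∀ a b : Fin m, ((s : Mat p m) - 1) a b ≠ 0 → b < a) :
    ∃ c : Mat p m → ℂ, RankSupp k c ∧ fourierFn c 1 = 1 ∧ ∀ s ∈ S, s ≠ 1 → fourierFn c s = 0 :=
  idTest_of_freeFrame S (Matrix.of fun (i : Fin m) (j : Fin k) => if i.val = j.val then (1 : ZMod p) else 0)
    fun s hs hfix =>
    eq_one_of_unitriangular_of_mul_idFrame hkm s (hS s hs) hfix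

/-- **The identity-design clause of the crux HOLDS for unitriangular triples at level `k ≥ m − 1`**, in the literal
shape of the hypothesis `hid` of `no_levelK_design_of_unitriangular` (there refuted for `k + 2 ≤ m`): if every
element of `H₁`, `H₂`, `H₃` is lower unitriangular and `m ≤ k + 1`, then there is `c` with `c_M = 0` for `rk M > k`,
`Σ_M c_M ψ(tr(M·1)) = 1` and `Σ_M c_M ψ(tr(M·abg)) = 0` whenever `a b g ≠ 1`. -/
theorem levelK_idDesign_of_unitriangular (k : ℕ) (hkm : m ≤ k + 1)
    {H₁ H₂ H₃ : Subgroup (Matrix.GeneralLinearGroup (Fin m) (ZMod p))}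
    (h₁ : ∀ u ∈ H₁, ∀ a b : Fin m, ((u : Mat p m) - 1) a b ≠ 0 → b < a)
    (h₂ : ∀ u ∈ H₂, ∀ a b : Fin m, ((u : Mat p m) - 1) a b ≠ 0 → b < a)
    (h₃ : ∀ u ∈ H₃, ∀ a b : Fin m, ((u : Mat p m) - 1) a b ≠ 0 → b < a) :
    ∃ c : Mat p m → ℂ, (∀ M : Mat p m, k < M.rank → c M = 0) ∧
      (∑ M : Mat p m, c M * ZMod.stdAddChar (Matrix.trace
        (M * ((1 : Matrix.GeneralLinearGroup (Fin m) (ZMod p)) : Mat p m)))) = 1 ∧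
      ∀ a ∈ H₁, ∀ b ∈ H₂, ∀ g ∈ H₃, a * b * g ≠ 1 →
        (∑ M : Mat p m, c M * ZMod.stdAddChar (Matrix.trace
          (M * ((a * b * g : Matrix.GeneralLinearGroup (Fin m) (ZMod p)) : Mat p m)))) = 0 := by
  -- the set of all lower unitriangular elements is closed under products
  let S : Set (GLm p m) := {s | ∀ a b : Fin m, ((s : Mat p m) - 1) a b ≠ 0 → b < a}
  have hmul : ∀ u v : GLm p m, u ∈ S → v ∈ S → u * v ∈ S := by
    intro u v hu hv a b hab
    by_contra hba
    apply hab
    -- entry (a,b) with ¬ b < a of `u v - 1 = (u-1)(v-1) + (u-1) + (v-1)` vanishes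
    have hu0 : ∀ a' b' : Fin m, ¬ b' < a' → ((u : Mat p m) - 1) a' b' = 0 := fun a' b' h => by
      by_contra h'; exact h (hu a' b' h')
    have hv0 : ∀ a' b' : Fin m, ¬ b' < a' → ((v : Mat p m) - 1) a' b' = 0 := fun a' b' h => by
      by_contra h'; exact h (hv a' b' h')
    have hexp : ((u * v : GLm p m) : Mat p m) - 1 =
        ((u : Mat p m) - 1) * ((v : Mat p m) - 1) + ((u : Mat p m) - 1) + ((v : Mat p m) - 1) := by
      push_cast
      noncomm_ring
    rw [hexp, Matrix.add_apply, Matrix.add_apply, Matrix.mul_apply, hu0 a b hba, hv0 a b hba, add_zero,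
      add_zero]
    refine Finset.sum_eq_zero fun l _ => ?_
    by_cases hla : l < a
    · have hbl : ¬ b < l := fun h => hba (lt_trans h hla)
      rw [hv0 l b hbl, mul_zero]
    · rw [hu0 a l hla, zero_mul]
  obtain ⟨c, hc, hc1, hc0⟩ := idTest_of_unitriangular k hkm S fun s hs => hs
  refine ⟨c, hc, ?_, fun a ha b hb g hg hne => ?_⟩
  · simpa [fourierFn] using hc1
  · have habg : a * b * g ∈ S := hmul _ _ (hmul _ _ (h₁ a ha) (h₂ b hb)) (h₃ g hg)
    simpa [fourierFn] using hc0 (a * b * g) habg hne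

end Summit.MatrixMultiplication.MatrixMultiplication.Theorems.SubgroupIdentityDesigns.Negative

end
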